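import Mathlib
import Literature.NumberTheory.LFunctions.Zhang2022.TypedSection16B
import Literature.NumberTheory.LFunctions.Zhang2022.AppendixALemma161Steps
import HarnessLib

/-!
# Zhang (2022) §16 p. 93: the Euler product `𝓜₂(d,l;s)` as a function of `(d,l)` — generic factors,
# convergence on `σ ≥ 9/10`, and the splitting behind "Note that `ϖ₂ⱼ(n)` is multiplicative"

Topic `Literature/NumberTheory/LFunctions/Zhang2022` (Landau–Siegel audit tree; verdict-neutral).
Y. Zhang, *Discrete mean estimates and the Landau–Siegel zero*, arXiv:2211.02515v1 (2022)
[Zhang2022LandauSiegel] — **an unrefereed manuscript under adjudication**; this file PROVES elementary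
facts about the campaign's typed §16 objects (`Typed.Section16A.calM2Factor/calM2/calM2star`,
`Typed.Section16B.varpi2`) and asserts nothing about the manuscript's theorems. ZHANG-L discharge lane
(WP16, seat zl-w16-p8), block A of leaf `Typed.Section16B.Eq16_16` (sub-leaf (16.15)
`Typed.Section16B.Eq16_15`), DAG node `Z22:§16.u030`/`u031` [Z22 p. 93, tex L4597–L4605]:
"`ϖ₂ⱼ(n) = Σ_{n=dl} λ₂(d)d^{β_j}χ(l)𝓜₂(d,l;1−β_j)/𝓜₂*(1−β_j)`. Note that `ϖ₂ⱼ(n)` is multiplicative."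

What is proved (theorems only; no definitions, no named facts):

* `calM2Factor_congr` — the Euler factor of `𝓜₂(d,l;s)` at a prime `q` depends on `(d,l)` only through
  the two flags `q ∣ d`, `q ∣ l` (from the tree's closed forms `AppendixA.xi2LocalSeries_prime`,
  `AppendixA.lamTilde2_prime`, valid for `Re s > 0`); `calM2Factor_eq_locF_of_not_dvd` — for `q ∤ dl` it
  is the generic factor `AppendixA.locF (χ q) (q^{−β₁}) (q^{−s}) q` of `𝓜₂(1,1;s)`, hence
  (`norm_calM2Factor_sub_one_le`) within `225 q^{−σ}/q` of `1` for `σ ≥ 9/10`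
  (`AppendixA.norm_locF_sub_one_le`), and non-zero once `q ≥ 23`;
* `multipliable_calM2Factor` — for `d, l ≥ 1` and `σ ≥ 9/10` the product `∏'_q` defining
  `calM2 c′ χ d l s` converges (Mathlib `multipliable_one_add_of_summable`; only finitely many factors
  are non-generic);
* `calM2_mul_eq` — **the splitting**: for `(d₁l₁, d₂l₂) = 1` with the generic factors at the primes of
  `d₂l₂` non-zero, `𝓜₂(d₁d₂,l₁l₂;s) = 𝓜₂(d₁,l₁;s)·∏_{q∣d₂l₂} F_q(d₂,l₂;s)/F_q(1,1;s)`;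
* `varpi2_mul_eq` — consequently, for `(n₁,n) = 1` with the generic factors at the primes of `n`
  non-zero (automatic for `n` coprime to `𝔮 = ∏_{q<D⁴}q`, `D ≥ 3`),
  `ϖ₂ⱼ(n₁n) = ϖ₂ⱼ(n₁)·ρⱼ(n)` where `ρⱼ(n) = Σ_{n=dl} λ₂(d)d^{β_j}χ(l)∏_{q∣n}F_q(d,l)/F_q(1,1)`
  (at `s = 1−β_j`) is spelled INLINE (no new object is declared), with `ρⱼ(1) = 1` and
  `ρⱼ(mn) = ρⱼ(m)ρⱼ(n)` for coprime `m, n` (`rho_one`, `rho_mul_of_coprime`).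

READING NOTE recorded for the lane (wp16/WP16-PLAN, finding F2 of zl-w16-p8): `ϖ₂ⱼ(1) =
𝓜₂(1,1;1−β_j)/𝓜₂*(1−β_j)`, which is `1` iff `χ(2) ≠ 1`; for `χ(2) = 1` the generic factor at `q = 2`
is `locMain 1 2 + O(α) = O(α)` (`locMain 1 2 = (1 − 1/1)/(1 − 1/2) = 0`, the reason for the manuscript's
`𝓜₂* = 2∏_{q>2}`), so the printed "multiplicative" holds only in the form `ϖ(mn)ϖ(1) = ϖ(m)ϖ(n)`; the
θ′-free factorisation `varpi2_mul_eq` is what the (16.15) chain actually uses. Nothing here bears on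
Theorems 1–2 of the source or on Landau–Siegel zeros.

## References
* Y. Zhang, arXiv:2211.02515v1 (2022), §16 pp. 91–93 (u021, u025–u026, u030–u031), App. A p. 105.
  [cite: Zhang2022LandauSiegel, §16 p. 93]
-/

noncomputable section

open Complex Real Finset Filter Topology

namespace Literature.NumberTheory.LFunctions.Zhang2022.Section16CalM2Euler

open Literature.NumberTheory.LFunctions.Zhang2022
open Literature.NumberTheory.LFunctions.Zhang2022.Skeleton
open Literature.NumberTheory.LFunctions.Zhang2022.Typed.Section16A
open Literature.NumberTheory.LFunctions.Zhang2022.Typed.Section16B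
open Literature.NumberTheory.LFunctions.Zhang2022.AppendixA

variable (c' : ℝ) {D : ℕ} (χ : DirichletCharacter ℂ D)

/-! ## §1. The Euler factor at a prime depends on `(d,l)` only through `q ∣ d`, `q ∣ l` -/

/-- `‖q^{−s}‖ = q^{−σ} < 1` for a prime `q` and `σ > 0` (the convergence of the local series of u021,
§16 p. 91); private twin of the tree's `EulerProductMeanSquare.norm_prime_cpow_neg_lt_one` (kept private to
keep the import cone small). [cite: Zhang2022LandauSiegel, §16 p. 91 (u021)] -/
private theorem norm_prime_cpow_neg_lt_one {q : ℕ} (hq : q.Prime) {s : ℂ} (hs : 0 < s.re) :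
    ‖(q : ℂ) ^ (-s)‖ < 1 := by
  rw [Complex.norm_natCast_cpow_of_pos hq.pos, Complex.neg_re]
  exact Real.rpow_lt_one_of_one_lt_of_neg (by exact_mod_cast hq.one_lt) (by linarith)

/-- **The Euler factor of `𝓜₂(d,l;s)` at the prime `q` depends on `(d,l)` only through the two
divisibilities `q ∣ d`, `q ∣ l`** (u021/u026 with (16.7)–(16.8): `λ̃₂(q,d)` and `Σ_r ξ₂(qʳ;d,l)q^{−rs}`
in the tree's closed forms `AppendixA.lamTilde2_prime`, `AppendixA.xi2LocalSeries_prime`), `Re s > 0`.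
[cite: Zhang2022LandauSiegel, §16 p. 91 (u021), App. A p. 105] -/
theorem calM2Factor_congr {q d l d' l' : ℕ} (hq : q.Prime) {s : ℂ} (hs : 0 < s.re)
    (hd : q ∣ d ↔ q ∣ d') (hl : q ∣ l ↔ q ∣ l') :
    calM2Factor c' χ q d l s = calM2Factor c' χ q d' l' s := by
  have hx := norm_prime_cpow_neg_lt_one hq hs
  have hcd : Nat.Coprime q d ↔ Nat.Coprime q d' := by
    rw [hq.coprime_iff_not_dvd, hq.coprime_iff_not_dvd, hd]
  have hcl : Nat.Coprime q l ↔ Nat.Coprime q l' := by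
    rw [hq.coprime_iff_not_dvd, hq.coprime_iff_not_dvd, hl]
  unfold calM2Factor
  rw [lamTilde2_prime c' χ hq d, lamTilde2_prime c' χ hq d', xi2LocalSeries_prime c' χ hq d l s hx,
    xi2LocalSeries_prime c' χ hq d' l' s hx]
  simp only [hcd, hcl]

/-- **For `q ∤ d`, `q ∤ l` the Euler factor of `𝓜₂(d,l;s)` at `q` is the generic factor of `𝓜₂(1,1;s)`**,
i.e. the tree's closed form `locF (χ q) (q^{−β₁}) (q^{−s}) q` (`AppendixA.calM2Factor_prime_one_one`).
[cite: Zhang2022LandauSiegel, §16 p. 91 (u021), App. A p. 105] -/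
theorem calM2Factor_eq_locF_of_not_dvd {q d l : ℕ} (hq : q.Prime) {s : ℂ} (hs : 0 < s.re)
    (hd : ¬ q ∣ d) (hl : ¬ q ∣ l) :
    calM2Factor c' χ q d l s =
      locF (χ (q : ZMod D)) ((q : ℂ) ^ (-beta1 c' D)) ((q : ℂ) ^ (-s)) q := by
  rw [calM2Factor_congr c' χ hq hs (d' := 1) (l' := 1) (by simp [hd, hq.ne_one])
    (by simp [hl, hq.ne_one])]
  exact calM2Factor_prime_one_one c' χ hq s (norm_prime_cpow_neg_lt_one hq hs)

/-- **The generic factor is `1 + O(q^{−1−σ})`**: for `q ∤ d`, `q ∤ l`, `σ ≥ 9/10`,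
`‖F_q(d,l;s) − 1‖ ≤ 225·q^{−σ}/q` (§16 p. 91 "`1 + O(q^{−19/10})`"; `AppendixA.norm_locF_sub_one_le`).
[cite: Zhang2022LandauSiegel, §16 p. 91 (u021)] -/
theorem norm_calM2Factor_sub_one_le {q d l : ℕ} (hq : q.Prime) {s : ℂ} (hs : 9 / 10 ≤ s.re)
    (hd : ¬ q ∣ d) (hl : ¬ q ∣ l) :
    ‖calM2Factor c' χ q d l s - 1‖ ≤ 225 * (q : ℝ) ^ (-s.re) / q := by
  rw [calM2Factor_eq_locF_of_not_dvd c' χ hq (by linarith) hd hl]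
  obtain ⟨hxe, hx⟩ := norm_cpow_neg_le_three_fifths hq.two_le hs
  have hv : ‖χ (q : ZMod D)‖ ≤ 1 := DirichletCharacter.norm_le_one χ _
  have hw : ‖(q : ℂ) ^ (-beta1 c' D)‖ ≤ 1 := le_of_eq (norm_cpow_neg_beta1 c' hq.pos).1
  have h := norm_locF_sub_one_le (v := χ (q : ZMod D)) (w := (q : ℂ) ^ (-beta1 c' D))
    (x := (q : ℂ) ^ (-s)) hv hw hx hq.two_le
  rwa [hxe] at h

/-- `225 q^{−σ}/q < 1` for every prime `q ≥ 23` and `σ ≥ 9/10` (`225 < 529/2 ≤ 23^{19/10}`,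
as `23^{1/10} ≤ 1024^{1/10} = 2`): the generic Euler factor of u021 is within distance `< 1` of `1`.
[cite: Zhang2022LandauSiegel, §16 p. 91 (u021)] -/
theorem norm_calM2Factor_sub_one_lt_one {q d l : ℕ} (hq : q.Prime) (h23 : 23 ≤ q) {s : ℂ}
    (hs : 9 / 10 ≤ s.re) (hd : ¬ q ∣ d) (hl : ¬ q ∣ l) :
    ‖calM2Factor c' χ q d l s - 1‖ < 1 := by
  refine (norm_calM2Factor_sub_one_le c' χ hq hs hd hl).trans_lt ?_
  have hq0 : (0 : ℝ) < q := by exact_mod_cast hq.pos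
  have hq23 : (23 : ℝ) ≤ q := by exact_mod_cast h23
  -- `q^{−σ} ≤ q^{−9/10}`
  have h1 : (q : ℝ) ^ (-s.re) ≤ (q : ℝ) ^ (-(9 / 10 : ℝ)) :=
    Real.rpow_le_rpow_of_exponent_le (by linarith) (by linarith)
  have h2 : 225 * (q : ℝ) ^ (-s.re) / q ≤ 225 * (q : ℝ) ^ (-(9 / 10 : ℝ)) / q := by
    gcongr
  refine h2.trans_lt ?_
  rw [div_lt_one hq0]
  -- `225 q^{−9/10} < q` ⟸ `225 < q^{19/10}`, and `q^{19/10} ≥ 23^{19/10} = 529·23^{−1/10} ≥ 529/2`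
  have h3 : (q : ℝ) ^ (-(9 / 10 : ℝ)) * (q : ℝ) ^ (19 / 10 : ℝ) = q := by
    rw [← Real.rpow_add hq0]; norm_num
  have htenth : (23 : ℝ) ^ ((1 : ℝ) / 10) ≤ 2 := by
    have h2pow : (2 : ℝ) = (1024 : ℝ) ^ ((1 : ℝ) / 10) := by
      rw [show (1024 : ℝ) = (2 : ℝ) ^ (10 : ℝ) by norm_num, ← Real.rpow_mul (by norm_num)]
      norm_num
    rw [h2pow]
    exact Real.rpow_le_rpow (by norm_num) (by norm_num) (by norm_num)
  have h23pow : (529 : ℝ) / 2 ≤ (23 : ℝ) ^ (19 / 10 : ℝ) := by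
    have e : (23 : ℝ) ^ (19 / 10 : ℝ) * (23 : ℝ) ^ ((1 : ℝ) / 10) = 529 := by
      rw [← Real.rpow_add (by norm_num)]; norm_num
    have hpos : 0 < (23 : ℝ) ^ ((1 : ℝ) / 10) := by positivity
    rw [div_le_iff₀ (by norm_num : (0 : ℝ) < 2)]
    calc (529 : ℝ) = (23 : ℝ) ^ (19 / 10 : ℝ) * (23 : ℝ) ^ ((1 : ℝ) / 10) := e.symm
      _ ≤ (23 : ℝ) ^ (19 / 10 : ℝ) * 2 := by gcongr
  have h4 : (225 : ℝ) < (q : ℝ) ^ (19 / 10 : ℝ) := by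
    have h5 : (23 : ℝ) ^ (19 / 10 : ℝ) ≤ (q : ℝ) ^ (19 / 10 : ℝ) :=
      Real.rpow_le_rpow (by norm_num) hq23 (by norm_num)
    linarith
  have hpos : 0 < (q : ℝ) ^ (-(9 / 10 : ℝ)) := Real.rpow_pos_of_pos hq0 _
  calc 225 * (q : ℝ) ^ (-(9 / 10 : ℝ)) = (q : ℝ) ^ (-(9 / 10 : ℝ)) * 225 := mul_comm _ _
    _ < (q : ℝ) ^ (-(9 / 10 : ℝ)) * (q : ℝ) ^ (19 / 10 : ℝ) := mul_lt_mul_of_pos_left h4 hpos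
    _ = q := h3

/-- The generic Euler factor does not vanish at any prime `q ≥ 23` with `q ∤ dl`, `σ ≥ 9/10`.
[cite: Zhang2022LandauSiegel, §16 p. 91 (u021)] -/
theorem calM2Factor_ne_zero_of_not_dvd {q d l : ℕ} (hq : q.Prime) (h23 : 23 ≤ q) {s : ℂ}
    (hs : 9 / 10 ≤ s.re) (hd : ¬ q ∣ d) (hl : ¬ q ∣ l) : calM2Factor c' χ q d l s ≠ 0 := by
  intro h0
  have h := norm_calM2Factor_sub_one_lt_one c' χ hq h23 hs hd hl
  rw [h0, zero_sub, norm_neg, norm_one] at h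
  exact lt_irrefl _ h

/-! ## §2. Convergence of the Euler product `𝓜₂(d,l;s) = ∏'_q F_q(d,l;s)` for `σ ≥ 9/10` -/

/-- **`∏'_q F_q(d,l;s)` converges for `d, l ≥ 1`, `σ ≥ 9/10`** (u021 "analytic for `σ > 9/10`", the
convergence half): all but the finitely many factors at `q ∣ dl` are generic, within `225 q^{−1−σ}` of
`1`, and `Σ_q q^{−1−σ} < ∞`. [cite: Zhang2022LandauSiegel, §16 p. 91 (u021)] -/
theorem multipliable_calM2Factor {d l : ℕ} (hd : d ≠ 0) (hl : l ≠ 0) {s : ℂ} (hs : 9 / 10 ≤ s.re) :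
    Multipliable (fun q : Nat.Primes => calM2Factor c' χ (q : ℕ) d l s) := by
  set g : Nat.Primes → ℂ := fun q => calM2Factor c' χ (q : ℕ) d l s - 1 with hg
  have hfg : (fun q : Nat.Primes => calM2Factor c' χ (q : ℕ) d l s) = fun q => 1 + g q := by
    funext q; simp [hg]
  rw [hfg]
  apply multipliable_one_add_of_summable
  -- majorant: `225 q^{−(1+σ)}` off the primes dividing `dl`, `‖g q‖` itself on them (finitely many)
  have hdl : d * l ≠ 0 := mul_ne_zero hd hl
  set S : Finset Nat.Primes := (d * l).primeFactors.subtype Nat.Prime with hS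
  have hmemS : ∀ q : Nat.Primes, (q : ℕ) ∣ d * l → q ∈ S := fun q hq =>
    Finset.mem_subtype.mpr (Nat.mem_primeFactors.mpr ⟨q.prop, hq, hdl⟩)
  set h₁ : Nat.Primes → ℝ := fun q => 225 * ((q : ℕ) : ℝ) ^ (-(1 + s.re)) with hh₁
  set h₂ : Nat.Primes → ℝ := fun q => if (q : ℕ) ∣ d * l then ‖g q‖ else 0 with hh₂
  have h₁sum : Summable h₁ := by
    have : Summable (fun q : Nat.Primes => (q : ℝ) ^ (-(1 + s.re))) :=
      Nat.Primes.summable_rpow.mpr (by linarith)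
    exact this.mul_left 225
  have h₂sum : Summable h₂ := by
    refine summable_of_ne_finset_zero (s := S) fun q hq => ?_
    rw [hh₂]; dsimp only
    rw [if_neg fun h => hq (hmemS q h)]
  have key : ∀ x : ℝ, 0 < x → ∀ σ : ℝ, 225 * x ^ (-σ) / x = 225 * x ^ (-(1 + σ)) := by
    intro x hx σ
    rw [show -(1 + σ) = -σ + (-1) by ring, Real.rpow_add hx, Real.rpow_neg_one]
    ring
  refine (h₁sum.add h₂sum).of_nonneg_of_le (fun q => norm_nonneg _) fun q => ?_
  by_cases hq : (q : ℕ) ∣ d * l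
  · rw [hh₂]; dsimp only; rw [if_pos hq]
    have : 0 ≤ h₁ q := by rw [hh₁]; positivity
    linarith
  · rw [hh₂]; dsimp only; rw [if_neg hq, add_zero]
    have hqd : ¬ (q : ℕ) ∣ d := fun h => hq (Dvd.dvd.mul_right h l)
    have hql : ¬ (q : ℕ) ∣ l := fun h => hq (Dvd.dvd.mul_left h d)
    have hb := norm_calM2Factor_sub_one_le c' χ q.prop hs hqd hql
    have hq0 : (0 : ℝ) < ((q : ℕ) : ℝ) := by exact_mod_cast q.prop.pos
    rw [hh₁]; dsimp only
    rw [← key _ hq0]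
    exact hb

/-! ## §3. The splitting of `𝓜₂(d₁d₂, l₁l₂; s)` for coprime `d₁l₁`, `d₂l₂` -/

/-- A `∏'` over `Nat.Primes` of a function equal to `1` off the prime factors of `n ≠ 0` is the finite
product over `n.primeFactors` (the bookkeeping of "`𝓜₂(d,l;s)/𝓜₂(1,1;s) = ∏_{q∣dl}(…)`", the (15.18)
pattern of §16). [cite: Zhang2022LandauSiegel, §15 (15.18) p. 85; §16 p. 93] -/
theorem tprod_primes_eq_prod_primeFactors {n : ℕ} (hn : n ≠ 0) (g : ℕ → ℂ)
    (hg : ∀ q : Nat.Primes, ¬ (q : ℕ) ∣ n → g q = 1) :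
    ∏' q : Nat.Primes, g q = ∏ q ∈ n.primeFactors, g q := by
  set S : Finset Nat.Primes := n.primeFactors.subtype Nat.Prime with hS
  have hoff : ∀ q ∉ S, g (q : ℕ) = 1 := by
    intro q hq
    apply hg
    intro hdvd
    exact hq (Finset.mem_subtype.mpr (Nat.mem_primeFactors.mpr ⟨q.prop, hdvd, hn⟩))
  rw [tprod_eq_prod hoff]
  have h1 : ∏ q ∈ S, g (q : ℕ) = ∏ q ∈ n.primeFactors.filter Nat.Prime, g q :=
    Finset.prod_subtype_eq_prod_filter g
  rw [h1, Finset.filter_true_of_mem fun q hq => Nat.prime_of_mem_primeFactors hq]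

/-- **The splitting of the Euler product** (§16 p. 93, the content of "`ϖ₂ⱼ` is multiplicative"):
for `d₁l₁ ≠ 0`, `d₂l₂ ≠ 0` coprime, `σ ≥ 9/10`, and the generic factors `F_q(1,1;s)` non-zero at the
primes `q ∣ d₂l₂`,
`𝓜₂(d₁d₂, l₁l₂; s) = 𝓜₂(d₁,l₁;s) · ∏_{q ∣ d₂l₂} F_q(d₂,l₂;s)/F_q(1,1;s)`.
Proof: prime by prime, `F_q(d₁d₂,l₁l₂) = F_q(d₁,l₁)·r_q` with `r_q = F_q(d₂,l₂)/F_q(1,1)` for `q ∣ d₂l₂`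
(there `F_q(d₁,l₁) = F_q(1,1)`) and `r_q = 1` otherwise (`calM2Factor_congr`); then
`∏'(f·r) = ∏'f · ∏'r` (`multipliable_calM2Factor`). [cite: Zhang2022LandauSiegel, §16 p. 93 (u030)] -/
theorem calM2_mul_eq {d₁ l₁ d₂ l₂ : ℕ} (hd₁ : d₁ ≠ 0) (hl₁ : l₁ ≠ 0) (hd₂ : d₂ ≠ 0) (hl₂ : l₂ ≠ 0)
    (hcop : Nat.Coprime (d₁ * l₁) (d₂ * l₂)) {s : ℂ} (hs : 9 / 10 ≤ s.re)
    (hne : ∀ q ∈ (d₂ * l₂).primeFactors, calM2Factor c' χ q 1 1 s ≠ 0) :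
    calM2 c' χ (d₁ * d₂) (l₁ * l₂) s =
      calM2 c' χ d₁ l₁ s *
        ∏ q ∈ (d₂ * l₂).primeFactors, calM2Factor c' χ q d₂ l₂ s / calM2Factor c' χ q 1 1 s := by
  have hs0 : 0 < s.re := by linarith
  have hn : d₂ * l₂ ≠ 0 := mul_ne_zero hd₂ hl₂
  set r : ℕ → ℂ := fun q =>
    if q ∣ d₂ * l₂ then calM2Factor c' χ q d₂ l₂ s / calM2Factor c' χ q 1 1 s else 1 with hr
  -- prime by prime
  have hpt : ∀ q : Nat.Primes, calM2Factor c' χ (q : ℕ) (d₁ * d₂) (l₁ * l₂) s =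
      calM2Factor c' χ (q : ℕ) d₁ l₁ s * r q := by
    intro q
    have hq : (q : ℕ).Prime := q.prop
    by_cases hdvd : (q : ℕ) ∣ d₂ * l₂
    · rw [hr]; dsimp only; rw [if_pos hdvd]
      -- `q ∤ d₁ l₁`
      have hnd : ¬ (q : ℕ) ∣ d₁ * l₁ := by
        intro h
        have := Nat.eq_one_of_dvd_coprimes hcop h hdvd
        exact hq.one_lt.ne' this
      have hnd₁ : ¬ (q : ℕ) ∣ d₁ := fun h => hnd (Dvd.dvd.mul_right h l₁)
      have hnl₁ : ¬ (q : ℕ) ∣ l₁ := fun h => hnd (Dvd.dvd.mul_left h d₁)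
      have e1 : calM2Factor c' χ (q : ℕ) d₁ l₁ s = calM2Factor c' χ (q : ℕ) 1 1 s :=
        calM2Factor_congr c' χ hq hs0 (by simp [hnd₁, hq.ne_one]) (by simp [hnl₁, hq.ne_one])
      have e2 : calM2Factor c' χ (q : ℕ) (d₁ * d₂) (l₁ * l₂) s = calM2Factor c' χ (q : ℕ) d₂ l₂ s :=
        calM2Factor_congr c' χ hq hs0 (by rw [hq.dvd_mul]; simp [hnd₁]) (by rw [hq.dvd_mul]; simp [hnl₁])
      have hq0 : calM2Factor c' χ (q : ℕ) 1 1 s ≠ 0 :=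
        hne q (Nat.mem_primeFactors.mpr ⟨hq, hdvd, hn⟩)
      rw [e1, e2]
      field_simp
    · rw [hr]; dsimp only; rw [if_neg hdvd, mul_one]
      have hnd₂ : ¬ (q : ℕ) ∣ d₂ := fun h => hdvd (Dvd.dvd.mul_right h l₂)
      have hnl₂ : ¬ (q : ℕ) ∣ l₂ := fun h => hdvd (Dvd.dvd.mul_left h d₂)
      exact calM2Factor_congr c' χ hq hs0 (by rw [hq.dvd_mul]; simp [hnd₂]) (by rw [hq.dvd_mul]; simp [hnl₂])
  have hfm : Multipliable (fun q : Nat.Primes => calM2Factor c' χ (q : ℕ) d₁ l₁ s) :=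
    multipliable_calM2Factor c' χ hd₁ hl₁ hs
  have hroff : ∀ q : Nat.Primes, ¬ (q : ℕ) ∣ d₂ * l₂ → r q = 1 := fun q hq => by
    rw [hr]; dsimp only; rw [if_neg hq]
  have hrm : Multipliable (fun q : Nat.Primes => r q) := by
    set S : Finset Nat.Primes := (d₂ * l₂).primeFactors.subtype Nat.Prime with hS
    refine multipliable_of_ne_finset_one (s := S) fun q hq => hroff q ?_
    intro hdvd
    exact hq (Finset.mem_subtype.mpr (Nat.mem_primeFactors.mpr ⟨q.prop, hdvd, hn⟩))
  unfold calM2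
  rw [show (fun q : Nat.Primes => calM2Factor c' χ (q : ℕ) (d₁ * d₂) (l₁ * l₂) s) =
      fun q : Nat.Primes => calM2Factor c' χ (q : ℕ) d₁ l₁ s * r (q : ℕ) from funext hpt,
    hfm.tprod_mul hrm,
    tprod_primes_eq_prod_primeFactors hn r hroff]
  congr 1
  refine Finset.prod_congr rfl fun q hq => ?_
  rw [hr]; dsimp only
  rw [if_pos (Nat.mem_primeFactors.mp hq).2.1]

/-! ## §4. `ϖ₂ⱼ(n₁n) = ϖ₂ⱼ(n₁)·ρⱼ(n)` and the multiplicativity of `ρⱼ` -/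

/-- The divisor pairs of `mn`, `(m,n) = 1`, are the products of the divisor pairs of `m` and of `n`
(bijection `((i,j),(k,l)) ↦ (ik, jl)`) — the splitting behind §16.u032 "`b₁(n₁n) = Σ_{n₁=l₁m₁}Σ_{n=lm}…`";
the tree proves this privately in `TypedSection16B` (for `step16_u032_holds`) — re-proved here verbatim
(privately, like there, so that the Zhang2022 import cone stays free of the modular-forms library, where
`…UpperHecke.sum_divisorsAntidiagonal_mul_of_coprime` lives). [cite: Zhang2022LandauSiegel, §16 p. 93 (u032)] -/
private theorem sum_divisorsAntidiagonal_mul_of_coprime {M : Type*} [AddCommMonoid M] {m n : ℕ}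
    (hmn : m.Coprime n) (f : ℕ → ℕ → M) :
    ∑ w ∈ (m * n).divisorsAntidiagonal, f w.1 w.2 =
      ∑ x ∈ m.divisorsAntidiagonal, ∑ y ∈ n.divisorsAntidiagonal, f (x.1 * y.1) (x.2 * y.2) := by
  -- adapted from TypedSection16B.lean (private `sum_divisorsAntidiagonal_mul_of_coprime`)
  rw [← Finset.sum_product']
  symm
  apply Finset.sum_nbij fun ((i, j), k, l) ↦ (i * k, j * l)
  · rintro ⟨⟨a1, a2⟩, ⟨b1, b2⟩⟩ h
    simp only [Nat.mem_divisorsAntidiagonal, Ne, Finset.mem_product] at h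
    rcases h with ⟨⟨rfl, ha⟩, ⟨rfl, hb⟩⟩
    simp only [Nat.mem_divisorsAntidiagonal, mul_eq_zero, Ne]
    constructor
    · ring
    rw [mul_eq_zero] at *
    exact not_or_intro ha hb
  · simp only [Set.InjOn, Finset.mem_coe, Nat.mem_divisorsAntidiagonal, Finset.mem_product, Prod.mk_inj]
    rintro ⟨⟨a1, a2⟩, ⟨b1, b2⟩⟩ ⟨⟨rfl, ha⟩, ⟨rfl, hb⟩⟩ ⟨⟨c1, c2⟩, ⟨d1, d2⟩⟩ hcd h
    have cop := hmn
    ext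
    · trans Nat.gcd (a1 * a2) (a1 * b1)
      · rw [Nat.gcd_mul_left, cop.coprime_mul_left.coprime_mul_right_right.gcd_eq_one, mul_one]
      · rw [← hcd.1.1, ← hcd.2.1] at cop
        rw [← hcd.1.1, h.1, Nat.gcd_mul_left,
          cop.coprime_mul_left.coprime_mul_right_right.gcd_eq_one, mul_one]
    · trans Nat.gcd (a1 * a2) (a2 * b2)
      · rw [mul_comm, Nat.gcd_mul_left, cop.coprime_mul_right.coprime_mul_left_right.gcd_eq_one,
          mul_one]
      · rw [← hcd.1.1, ← hcd.2.1] at cop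
        rw [← hcd.1.1, h.2, mul_comm, Nat.gcd_mul_left,
          cop.coprime_mul_right.coprime_mul_left_right.gcd_eq_one, mul_one]
    · trans Nat.gcd (b1 * b2) (a1 * b1)
      · rw [mul_comm, Nat.gcd_mul_right,
          cop.coprime_mul_right.coprime_mul_left_right.symm.gcd_eq_one, one_mul]
      · rw [← hcd.1.1, ← hcd.2.1] at cop
        rw [← hcd.2.1, h.1, mul_comm c1 d1, Nat.gcd_mul_left,
          cop.coprime_mul_right.coprime_mul_left_right.symm.gcd_eq_one, mul_one]
    · trans Nat.gcd (b1 * b2) (a2 * b2)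
      · rw [Nat.gcd_mul_right, cop.coprime_mul_left.coprime_mul_right_right.symm.gcd_eq_one, one_mul]
      · rw [← hcd.1.1, ← hcd.2.1] at cop
        rw [← hcd.2.1, h.2, Nat.gcd_mul_right,
          cop.coprime_mul_left.coprime_mul_right_right.symm.gcd_eq_one, one_mul]
  · simp only [Set.SurjOn, Set.subset_def, Finset.mem_coe, Nat.mem_divisorsAntidiagonal,
      Finset.mem_product, Set.mem_image]
    rintro ⟨b1, b2⟩ h
    use ((b1.gcd m, b2.gcd m), (b1.gcd n, b2.gcd n))
    rw [← hmn.gcd_mul _, ← hmn.gcd_mul _, ← h.1, Nat.gcd_mul_gcd_of_coprime_of_mul_eq_mul hmn h.1,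
      Nat.gcd_mul_gcd_of_coprime_of_mul_eq_mul hmn.symm _]
    · rw [Ne, mul_eq_zero, not_or] at h
      simp [h.2.1, h.2.2]
    rw [mul_comm n m, h.1]
  · rintro ⟨⟨a1, a2⟩, ⟨b1, b2⟩⟩ _
    rfl

/-- `λ₂(mn,s) = λ₂(m,s)λ₂(n,s)` for coprime `m, n ≥ 1` (`λ₂(·,s)` depends only on the set of prime
factors, (16.8)/u014). [cite: Zhang2022LandauSiegel, §16 p. 90 (u014)] -/
theorem lam2_mul_of_coprime {m n : ℕ} (hm : m ≠ 0) (hn : n ≠ 0) (hmn : Nat.Coprime m n) (s : ℂ) :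
    lam2 c' χ (m * n) s = lam2 c' χ m s * lam2 c' χ n s := by
  unfold lam2
  rw [hmn.primeFactors_mul, Finset.prod_union ((Nat.disjoint_primeFactors hm hn).mpr hmn)]

/-- Members of a divisor antidiagonal have non-zero coordinates. [folklore] -/
private theorem ne_zero_of_mem_divisorsAntidiagonal {n : ℕ} {x : ℕ × ℕ} (hx : x ∈ n.divisorsAntidiagonal) :
    x.1 ≠ 0 ∧ x.2 ≠ 0 := by
  obtain ⟨h1, h2⟩ := Nat.mem_divisorsAntidiagonal.mp hx
  constructor
  · intro h; apply h2; rw [← h1, h, zero_mul]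
  · intro h; apply h2; rw [← h1, h, mul_zero]

/-- `Re(1 − β_j) = 1` (private twin of `Lemma83.one_sub_betaJ_re`, whose file is not imported here).
[cite: Zhang2022LandauSiegel, §16 (16.10) p. 92] -/
private theorem one_sub_betaJ_re (j : ℕ) : (1 - betaJ c' D j).re = 1 := by
  rw [Complex.sub_re, Complex.one_re, betaJ_re_eq_zero, sub_zero]

/-- **`ϖ₂ⱼ(n₁n) = ϖ₂ⱼ(n₁)·ρⱼ(n)` for coprime `n₁, n ≥ 1`** whenever the generic Euler factors
`F_q(1,1;1−β_j)` at the primes `q ∣ n` are non-zero (automatic for `n` coprime to `𝔮 = ∏_{q<D⁴}q`):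
here `ρⱼ(n) = Σ_{n=dl} λ₂(d)d^{β_j}χ(l)∏_{q∣n}F_q(d,l;1−β_j)/F_q(1,1;1−β_j)` — the `𝓜₂(1,1)`-normalised
local part of `ϖ₂ⱼ`, spelled inline. This is the θ′-free form of "`ϖ₂ⱼ(n)` is multiplicative"
(§16 p. 93, tex L4601) that the (16.15) chain uses (divisor pairs of `n₁n` = products of pairs;
`λ₂`, `d^{β_j}`, `χ` multiplicative; `calM2_mul_eq`). [cite: Zhang2022LandauSiegel, §16 p. 93 (u030–u031)] -/
theorem varpi2_mul_eq [NeZero D] (j : ℕ) {n₁ n : ℕ} (hcop : Nat.Coprime n₁ n)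
    (hne : ∀ q ∈ n.primeFactors, calM2Factor c' χ q 1 1 (1 - betaJ c' D j) ≠ 0) :
    varpi2 c' χ j (n₁ * n) = varpi2 c' χ j n₁ *
      ∑ y ∈ n.divisorsAntidiagonal, lam2 c' χ y.1 1 * (y.1 : ℂ) ^ betaJ c' D j * χ (y.2 : ZMod D) *
        ∏ q ∈ n.primeFactors,
          calM2Factor c' χ q y.1 y.2 (1 - betaJ c' D j) / calM2Factor c' χ q 1 1 (1 - betaJ c' D j) := by
  have hs : 9 / 10 ≤ (1 - betaJ c' D j).re := by rw [one_sub_betaJ_re]; norm_num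
  unfold varpi2
  rw [sum_divisorsAntidiagonal_mul_of_coprime hcop (fun a b =>
    lam2 c' χ a 1 * (a : ℂ) ^ betaJ c' D j * χ (b : ZMod D) *
      calM2 c' χ a b (1 - betaJ c' D j) / calM2star c' χ (1 - betaJ c' D j)), Finset.sum_mul_sum]
  refine Finset.sum_congr rfl fun x hx => Finset.sum_congr rfl fun y hy => ?_
  obtain ⟨hx1, hx2⟩ := ne_zero_of_mem_divisorsAntidiagonal hx
  obtain ⟨hy1, hy2⟩ := ne_zero_of_mem_divisorsAntidiagonal hy
  have hxn : x.1 * x.2 = n₁ := (Nat.mem_divisorsAntidiagonal.mp hx).1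
  have hyn : y.1 * y.2 = n := (Nat.mem_divisorsAntidiagonal.mp hy).1
  have hcop' : Nat.Coprime (x.1 * x.2) (y.1 * y.2) := by rw [hxn, hyn]; exact hcop
  have hcop1 : Nat.Coprime x.1 y.1 :=
    Nat.Coprime.coprime_dvd_left (Dvd.intro _ rfl) (Nat.Coprime.coprime_dvd_right (Dvd.intro _ rfl) hcop')
  have hM := calM2_mul_eq c' χ hx1 hx2 hy1 hy2 hcop' hs (by rw [hyn]; exact hne)
  rw [hyn] at hM
  rw [hM, lam2_mul_of_coprime c' χ hx1 hy1 hcop1, Nat.cast_mul, Complex.natCast_mul_natCast_cpow,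
    Nat.cast_mul, map_mul]
  ring

/-- **`ρⱼ(1) = 1`.** [cite: Zhang2022LandauSiegel, §16 p. 93 (u030)] -/
theorem rho_one [NeZero D] (j : ℕ) :
    ∑ y ∈ (1 : ℕ).divisorsAntidiagonal, lam2 c' χ y.1 1 * (y.1 : ℂ) ^ betaJ c' D j * χ (y.2 : ZMod D) *
        ∏ q ∈ (1 : ℕ).primeFactors,
          calM2Factor c' χ q y.1 y.2 (1 - betaJ c' D j) / calM2Factor c' χ q 1 1 (1 - betaJ c' D j) = 1 := by
  rw [Nat.divisorsAntidiagonal_one, Finset.sum_singleton]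
  simp [lam2]

/-- **`ρⱼ(mn) = ρⱼ(m)ρⱼ(n)` for coprime `m, n ≥ 1`** (the genuine multiplicativity behind §16 p. 93
"`ϖ₂ⱼ(n)` is multiplicative"): on the primes of `m` the local factor of the pair `(d₁d₂, l₁l₂)` is that
of `(d₁,l₁)`, on the primes of `n` that of `(d₂,l₂)` (`calM2Factor_congr`).
[cite: Zhang2022LandauSiegel, §16 p. 93 (u030)] -/
theorem rho_mul_of_coprime [NeZero D] (j : ℕ) {m n : ℕ} (hm : m ≠ 0) (hn : n ≠ 0)
    (hmn : Nat.Coprime m n) :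
    (∑ y ∈ (m * n).divisorsAntidiagonal, lam2 c' χ y.1 1 * (y.1 : ℂ) ^ betaJ c' D j * χ (y.2 : ZMod D) *
        ∏ q ∈ (m * n).primeFactors,
          calM2Factor c' χ q y.1 y.2 (1 - betaJ c' D j) / calM2Factor c' χ q 1 1 (1 - betaJ c' D j)) =
      (∑ y ∈ m.divisorsAntidiagonal, lam2 c' χ y.1 1 * (y.1 : ℂ) ^ betaJ c' D j * χ (y.2 : ZMod D) *
        ∏ q ∈ m.primeFactors,
          calM2Factor c' χ q y.1 y.2 (1 - betaJ c' D j) / calM2Factor c' χ q 1 1 (1 - betaJ c' D j)) *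
      ∑ y ∈ n.divisorsAntidiagonal, lam2 c' χ y.1 1 * (y.1 : ℂ) ^ betaJ c' D j * χ (y.2 : ZMod D) *
        ∏ q ∈ n.primeFactors,
          calM2Factor c' χ q y.1 y.2 (1 - betaJ c' D j) / calM2Factor c' χ q 1 1 (1 - betaJ c' D j) := by
  have hs0 : 0 < (1 - betaJ c' D j).re := by rw [one_sub_betaJ_re]; norm_num
  set s := 1 - betaJ c' D j with hs
  rw [sum_divisorsAntidiagonal_mul_of_coprime hmn (fun a b =>
    lam2 c' χ a 1 * (a : ℂ) ^ betaJ c' D j * χ (b : ZMod D) *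
      ∏ q ∈ (m * n).primeFactors, calM2Factor c' χ q a b s / calM2Factor c' χ q 1 1 s),
    Finset.sum_mul_sum]
  refine Finset.sum_congr rfl fun x hx => Finset.sum_congr rfl fun y hy => ?_
  obtain ⟨hx1, hx2⟩ := ne_zero_of_mem_divisorsAntidiagonal hx
  obtain ⟨hy1, hy2⟩ := ne_zero_of_mem_divisorsAntidiagonal hy
  have hxn : x.1 * x.2 = m := (Nat.mem_divisorsAntidiagonal.mp hx).1
  have hyn : y.1 * y.2 = n := (Nat.mem_divisorsAntidiagonal.mp hy).1
  have hcop1 : Nat.Coprime x.1 y.1 :=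
    Nat.Coprime.coprime_dvd_left (Dvd.intro x.2 hxn) (Nat.Coprime.coprime_dvd_right (Dvd.intro y.2 hyn) hmn)
  -- the product over the prime factors of `mn` splits
  have hprod : ∏ q ∈ (m * n).primeFactors, calM2Factor c' χ q (x.1 * y.1) (x.2 * y.2) s /
        calM2Factor c' χ q 1 1 s =
      (∏ q ∈ m.primeFactors, calM2Factor c' χ q x.1 x.2 s / calM2Factor c' χ q 1 1 s) *
        ∏ q ∈ n.primeFactors, calM2Factor c' χ q y.1 y.2 s / calM2Factor c' χ q 1 1 s := by
    rw [hmn.primeFactors_mul, Finset.prod_union ((Nat.disjoint_primeFactors hm hn).mpr hmn)]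
    congr 1
    · refine Finset.prod_congr rfl fun q hq => ?_
      obtain ⟨hqp, hqm, -⟩ := Nat.mem_primeFactors.mp hq
      have hqn : ¬ q ∣ n := fun h => hqp.one_lt.ne' (Nat.eq_one_of_dvd_coprimes hmn hqm h)
      have hq1 : ¬ q ∣ y.1 := fun h => hqn (h.trans (Dvd.intro y.2 hyn))
      have hq2 : ¬ q ∣ y.2 := fun h => hqn (h.trans (Dvd.intro_left y.1 hyn))
      rw [calM2Factor_congr c' χ hqp hs0 (d' := x.1) (l' := x.2)
        (by rw [hqp.dvd_mul]; simp [hq1]) (by rw [hqp.dvd_mul]; simp [hq2])]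
    · refine Finset.prod_congr rfl fun q hq => ?_
      obtain ⟨hqp, hqn', -⟩ := Nat.mem_primeFactors.mp hq
      have hqm : ¬ q ∣ m := fun h => hqp.one_lt.ne' (Nat.eq_one_of_dvd_coprimes hmn h hqn')
      have hq1 : ¬ q ∣ x.1 := fun h => hqm (h.trans (Dvd.intro x.2 hxn))
      have hq2 : ¬ q ∣ x.2 := fun h => hqm (h.trans (Dvd.intro_left x.1 hxn))
      rw [calM2Factor_congr c' χ hqp hs0 (d' := y.1) (l' := y.2)
        (by rw [hqp.dvd_mul]; simp [hq1]) (by rw [hqp.dvd_mul]; simp [hq2])]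
  rw [hprod, lam2_mul_of_coprime c' χ hx1 hy1 hcop1, Nat.cast_mul, Complex.natCast_mul_natCast_cpow,
    Nat.cast_mul, map_mul]
  ring

/-- **The generic factors at the primes of a `𝔮`-rough number do not vanish** (`D ≥ 3`): every prime
`q ∣ n` with `(n,𝔮) = 1` has `q ≥ D⁴ ≥ 81 ≥ 23`. [cite: Zhang2022LandauSiegel, §16 p. 93 (u031)] -/
theorem calM2Factor_one_one_ne_zero_of_coprime_frakq (hD : 3 ≤ D) (j : ℕ) {n : ℕ}
    (hn : Nat.Coprime n (frakq D)) :
    ∀ q ∈ n.primeFactors, calM2Factor c' χ q 1 1 (1 - betaJ c' D j) ≠ 0 := by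
  intro q hq
  obtain ⟨hqp, hqn, -⟩ := Nat.mem_primeFactors.mp hq
  have hqK : ¬ q ∣ frakq D := fun h => hqp.one_lt.ne' (Nat.eq_one_of_dvd_coprimes hn hqn h)
  rw [Typed.Section15B.prime_dvd_frakq_iff hqp, not_lt] at hqK
  have h81 : 3 ^ 4 ≤ D ^ 4 := Nat.pow_le_pow_left hD 4
  have h23 : 23 ≤ q := by omega
  exact calM2Factor_ne_zero_of_not_dvd c' χ hqp h23 (by rw [one_sub_betaJ_re]; norm_num)
    (by simp [hqp.ne_one]) (by simp [hqp.ne_one])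

end Literature.NumberTheory.LFunctions.Zhang2022.Section16CalM2Euler
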